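import Literature.Analysis.FluidPDE.CKNEpsilonRegularityForce
import Literature.Analysis.FluidPDE.CKNPressureEstimate
import HarnessLib

/-!
# The two-scale pressure estimate with a general force (towards Lemarié-Rieusset's Lemma 14.2)

Analysis/FluidPDE support file (everything proved, no definitions, no named facts) in the
decomposition of the named fact `Literature.Analysis.FluidPDE.lemarieRieusset_lemma_14_2`
(`CKNEpsilonRegularityProofs.lean`: P. G. Lemarié-Rieusset, *The Navier–Stokes Problem in the
21st Century*, §14.3, Lemma 14.2).

The pressure step of the printed proof (scan pp. 506–507, (14.20)) splits the localised pressure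
as `ζp = p_ρ + q_ρ + ϖ_ρ` through the Newtonian kernel, with the harmonic part `p_ρ`, the
Calderón–Zygmund part `q_ρ` of `u ⊗ u`, and the **force part**
`ϖ_ρ = G * (f·∇ζ) - G * div(ζ f)` ("`‖ϖ(s,·)‖_{L^{3/2}(B(x,r))} ≤ C' r ‖f(s,·)‖_{L^{3/2}(B(x,ρ))}`"),
the force `f ∈ L^q_t L^q_x` being *not* assumed solenoidal in §14.3. The tree's local pressure
estimate `pressureEstimate` (`CKNEpsilonRegularityAssembly`, proved in `CKNPressureEstimate`:
`D(θr) ≤ κ₅ θ^{-3/2} A(r)^{3/4} E(r)^{3/4} + κ₆ θ D(r)`, Robinson–Rodrigo–Sadowski 2016,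
Lemma 16.7) needs `div f = 0`. This file removes that assumption in the way of
Caffarelli–Kohn–Nirenberg 1982, §1 ("if `f` is not divergence free, its gradient part may be
absorbed into the pressure"), using the tree's localised Helmholtz decomposition on a unit
cylinder (`LocalHelmholtz.exists_localHelmholtz`, `isLRSuitableWeakSolutionOn_absorb`,
`divFree_absorb` of `CKNEpsilonRegularityForce`): on `Q_1(w)` write `1_{Q_1(w)} f = (f - 𝒢) + 𝒢`
with `𝒢 = ∇ₓπ`, `div (f - 𝒢) = 0` on `Q_1(w)`, `‖π‖_{L^{3/2}} ≤ C ‖1_{Q_1(w)} f‖_{L^{3/2}}`; the pair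
`(u, p - π)` with force `f - 𝒢` is again suitable (unit viscosity), so `pressureEstimate` applies
to `p - π` on any cylinder `Q_r(z)` with `closure Q_r(z) ⊆ Q_1(w)`, and
`|p|^{3/2} ≤ 2(|p - π|^{3/2} + |π|^{3/2})` puts back `p` at the price of the full `L^{3/2}` mass of
`π`, i.e. of `(∫∫_{Q_1(w)} |f|^q)^{3/(2q)}` (Hölder). This is the rôle of `ϖ_ρ` in (14.20).

* `IsLRSuitableWeakSolutionOn.isSuitableWeakSolutionOn` — the global classes of §14.3 give the
  local classes of Caffarelli–Kohn–Nirenberg's (2.1)–(2.5) (`Fluid.IsSuitableWeakSolutionOn`).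
* `cknD_le_two_mul_sub`, `cknD_sub_le_two_mul` — `D(s; p) ≤ 2 (D(s; p - π) + s⁻² ∫∫ |π|^{3/2})`
  and conversely.
* `pressureEstimate_force_unit` — for `q ≥ 3/2` there are `κ₅, κ₆, κ₇` such that for
  `(Ω, f, u, p, G)` in the class of §14.3 with `ν = 1`, a unit cylinder `Q_1(w) ⊆ Ω` on which
  `u ∈ L³`, every `closure Q_r(z) ⊆ Q_1(w)` and `0 < θ ≤ 1/2`:
  `D(θr; z) ≤ κ₅ θ^{-3/2} A(r; z)^{3/4} E(r; z)^{3/4} + κ₆ θ D(r; z) + κ₇ θ⁻² r⁻² F_q(1; w)^{3/(2q)}`.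
* `pressureEstimate_force` — every scale: the same with an absorption cylinder `Q_R(w) ⊆ Ω`,
  `closure Q_r(z) ⊆ Q_R(w)`, force term `κ₇ θ⁻² (R/r)² F_q(R; w)^{3/(2q)}` (Navier–Stokes scaling,
  `IsLRSuitableWeakSolutionOn.nsRescale`).

## References

* P. G. Lemarié-Rieusset, *The Navier–Stokes Problem in the 21st Century*, 2nd ed., CRC Press,
  §14.3, proof of Thm. 14.4, the splitting `ζp = p_ρ + q_ρ + ϖ_ρ` and (14.20) (scan pp. 506–507).
  [Lemarierieusset2023]
* L. Caffarelli, R. Kohn, L. Nirenberg, *Partial regularity of suitable weak solutions of the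
  Navier–Stokes equations*, Comm. Pure Appl. Math. 35 (1982), §1. [CaffarelliKohnNirenberg1982]
* J. C. Robinson, J. L. Rodrigo, W. Sadowski, *The three-dimensional Navier–Stokes equations*,
  CUP (2016), Lemma 16.7. [RobinsonRodrigoSadowski2016]
-/

noncomputable section

open MeasureTheory Set Function Filter Topology TopologicalSpace Metric
open scoped NNReal ENNReal InnerProductSpace RealInnerProductSpace Laplacian

namespace Literature.Analysis.FluidPDE

open AbsorbForce LocalHelmholtz

/-- Local notation for physical space `ℝ³ = EuclideanSpace ℝ (Fin 3)`. -/
local notation "ℝ³" => EuclideanSpace ℝ (Fin 3)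

/-- The exponent `3/2`, in the coerced form of `LocalHelmholtzSlice`. -/
local notation "p₃₂" => ((3 / 2 : ℝ≥0) : ℝ≥0∞)

/-! ### From the global classes of §14.3 to the local classes of Caffarelli–Kohn–Nirenberg -/

/-- **The §14.3 hypotheses imply Caffarelli–Kohn–Nirenberg's (2.1)–(2.5)**: the global classes
`u ∈ L^∞_t L²_x(Q)`, `∇u ∈ L²(Q)`, `p ∈ L^{3/2}(Q)` give the local ones, with the same weak
gradient and local energy inequality. [folklore] -/
theorem IsLRSuitableWeakSolutionOn.isSuitableWeakSolutionOn {Q : Opens (ℝ × ℝ³)} {ν q : ℝ}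
    {f u : ℝ → ℝ³ → ℝ³} {p : ℝ → ℝ³ → ℝ} {G : ℝ → ℝ³ → ℝ³ →L[ℝ] ℝ³}
    (h : IsLRSuitableWeakSolutionOn Q ν q f u p G) : IsSuitableWeakSolutionOn Q ν f u p where
  distributional := h.distributional
  energyClass K hK _ := by
    obtain ⟨C, hC⟩ := h.energyClass
    refine ⟨C, hC.mono fun t ht => (lintegral_mono fun x => ?_).trans ht⟩
    exact indicator_le_indicator_of_subset hK (fun _ => zero_le) _
  pressure K hK _ := lt_of_le_of_lt (lintegral_mono_set hK) h.pressure_lt_top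
  localEnergy := ⟨G, h.weakGradient, fun K hK _ =>
    lt_of_le_of_lt (lintegral_mono_set hK) h.gradient_lt_top, h.localEnergy⟩

/-! ### Comparing `D` for `p` and `p - π` -/

section Compare

variable {p : ℝ → ℝ³ → ℝ} {π : ℝ × ℝ³ → ℝ} {s : ℝ} {z : ℝ × ℝ³}

/-- `|a|^{3/2} ≤ 2 (|a - b|^{3/2} + |b|^{3/2})` in `ℝ≥0∞`. [folklore] -/
theorem enorm_rpow_le_two_mul_sub (a b : ℝ) :
    ‖a‖ₑ ^ (3 / 2 : ℝ) ≤ 2 * (‖a - b‖ₑ ^ (3 / 2 : ℝ) + ‖b‖ₑ ^ (3 / 2 : ℝ)) := by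
  have h1 : ‖a‖ₑ ≤ ‖a - b‖ₑ + ‖b‖ₑ := by
    calc ‖a‖ₑ = ‖(a - b) + b‖ₑ := by rw [sub_add_cancel]
      _ ≤ ‖a - b‖ₑ + ‖b‖ₑ := enorm_add_le _ _
  have h2 := ENNReal.rpow_add_le_mul_rpow_add_rpow ‖a - b‖ₑ ‖b‖ₑ (by norm_num : (1 : ℝ) ≤ 3 / 2)
  have h3 : (2 : ℝ≥0∞) ^ ((3 / 2 : ℝ) - 1) ≤ 2 := by
    calc (2 : ℝ≥0∞) ^ ((3 / 2 : ℝ) - 1) ≤ (2 : ℝ≥0∞) ^ (1 : ℝ) :=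
          ENNReal.rpow_le_rpow_of_exponent_le (by norm_num) (by norm_num)
      _ = 2 := ENNReal.rpow_one 2
  calc ‖a‖ₑ ^ (3 / 2 : ℝ) ≤ (‖a - b‖ₑ + ‖b‖ₑ) ^ (3 / 2 : ℝ) := ENNReal.rpow_le_rpow h1 (by norm_num)
    _ ≤ (2 : ℝ≥0∞) ^ ((3 / 2 : ℝ) - 1) * (‖a - b‖ₑ ^ (3 / 2 : ℝ) + ‖b‖ₑ ^ (3 / 2 : ℝ)) := h2
    _ ≤ 2 * (‖a - b‖ₑ ^ (3 / 2 : ℝ) + ‖b‖ₑ ^ (3 / 2 : ℝ)) := by gcongr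

/-- `|a - b|^{3/2} ≤ 2 (|a|^{3/2} + |b|^{3/2})` in `ℝ≥0∞`. [folklore] -/
theorem enorm_sub_rpow_le_two_mul (a b : ℝ) :
    ‖a - b‖ₑ ^ (3 / 2 : ℝ) ≤ 2 * (‖a‖ₑ ^ (3 / 2 : ℝ) + ‖b‖ₑ ^ (3 / 2 : ℝ)) := by
  have h := enorm_rpow_le_two_mul_sub (a - b) (-b)
  rwa [sub_neg_eq_add, sub_add_cancel, enorm_neg] at h

/-- **`D(s; p) ≤ 2 (D(s; p - π) + s⁻² ∫∫ |π|^{3/2})`** (the full `L^{3/2}` mass of `π`). [folklore] -/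
theorem cknD_le_two_mul_sub (hπ : AEStronglyMeasurable π volume) (s : ℝ) (z : ℝ × ℝ³)
    (p : ℝ → ℝ³ → ℝ) :
    cknD s z p ≤ 2 * (cknD s z (fun t x => p t x - π (t, x)) +
      (ENNReal.ofReal s ^ 2)⁻¹ * ∫⁻ v, ‖π v‖ₑ ^ (3 / 2 : ℝ)) := by
  have hm : AEMeasurable (fun v : ℝ × ℝ³ => ‖π v‖ₑ ^ (3 / 2 : ℝ))
      (volume.restrict (parabolicCylinder s z)) :=
    (hπ.aemeasurable.enorm.pow_const _).restrict
  have h1 : ∫⁻ v in parabolicCylinder s z, ‖p v.1 v.2‖ₑ ^ (3 / 2 : ℝ) ≤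
      2 * ((∫⁻ v in parabolicCylinder s z, ‖p v.1 v.2 - π (v.1, v.2)‖ₑ ^ (3 / 2 : ℝ)) +
        ∫⁻ v, ‖π v‖ₑ ^ (3 / 2 : ℝ)) := by
    calc ∫⁻ v in parabolicCylinder s z, ‖p v.1 v.2‖ₑ ^ (3 / 2 : ℝ)
        ≤ ∫⁻ v in parabolicCylinder s z,
            2 * (‖p v.1 v.2 - π (v.1, v.2)‖ₑ ^ (3 / 2 : ℝ) + ‖π v‖ₑ ^ (3 / 2 : ℝ)) :=
          lintegral_mono fun v => enorm_rpow_le_two_mul_sub _ _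
      _ = 2 * ((∫⁻ v in parabolicCylinder s z, ‖p v.1 v.2 - π (v.1, v.2)‖ₑ ^ (3 / 2 : ℝ)) +
            ∫⁻ v in parabolicCylinder s z, ‖π v‖ₑ ^ (3 / 2 : ℝ)) := by
          rw [lintegral_const_mul' _ _ ENNReal.ofNat_ne_top, lintegral_add_right' _ hm]
      _ ≤ _ := by
          gcongr
          exact Measure.restrict_le_self
  simp only [cknD]
  calc (ENNReal.ofReal s ^ 2)⁻¹ * ∫⁻ v in parabolicCylinder s z, ‖p v.1 v.2‖ₑ ^ (3 / 2 : ℝ)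
      ≤ (ENNReal.ofReal s ^ 2)⁻¹ * (2 * ((∫⁻ v in parabolicCylinder s z,
          ‖p v.1 v.2 - π (v.1, v.2)‖ₑ ^ (3 / 2 : ℝ)) + ∫⁻ v, ‖π v‖ₑ ^ (3 / 2 : ℝ))) := by
        gcongr
    _ = _ := by ring

/-- **`D(s; p - π) ≤ 2 (D(s; p) + s⁻² ∫∫ |π|^{3/2})`.** [folklore] -/
theorem cknD_sub_le_two_mul (hπ : AEStronglyMeasurable π volume) (s : ℝ) (z : ℝ × ℝ³)
    (p : ℝ → ℝ³ → ℝ) :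
    cknD s z (fun t x => p t x - π (t, x)) ≤ 2 * (cknD s z p +
      (ENNReal.ofReal s ^ 2)⁻¹ * ∫⁻ v, ‖π v‖ₑ ^ (3 / 2 : ℝ)) := by
  have hm : AEMeasurable (fun v : ℝ × ℝ³ => ‖π v‖ₑ ^ (3 / 2 : ℝ))
      (volume.restrict (parabolicCylinder s z)) :=
    (hπ.aemeasurable.enorm.pow_const _).restrict
  have h1 : ∫⁻ v in parabolicCylinder s z, ‖p v.1 v.2 - π (v.1, v.2)‖ₑ ^ (3 / 2 : ℝ) ≤
      2 * ((∫⁻ v in parabolicCylinder s z, ‖p v.1 v.2‖ₑ ^ (3 / 2 : ℝ)) +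
        ∫⁻ v, ‖π v‖ₑ ^ (3 / 2 : ℝ)) := by
    calc ∫⁻ v in parabolicCylinder s z, ‖p v.1 v.2 - π (v.1, v.2)‖ₑ ^ (3 / 2 : ℝ)
        ≤ ∫⁻ v in parabolicCylinder s z,
            2 * (‖p v.1 v.2‖ₑ ^ (3 / 2 : ℝ) + ‖π v‖ₑ ^ (3 / 2 : ℝ)) :=
          lintegral_mono fun v => enorm_sub_rpow_le_two_mul _ _
      _ = 2 * ((∫⁻ v in parabolicCylinder s z, ‖p v.1 v.2‖ₑ ^ (3 / 2 : ℝ)) +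
            ∫⁻ v in parabolicCylinder s z, ‖π v‖ₑ ^ (3 / 2 : ℝ)) := by
          rw [lintegral_const_mul' _ _ ENNReal.ofNat_ne_top, lintegral_add_right' _ hm]
      _ ≤ _ := by
          gcongr
          exact Measure.restrict_le_self
  simp only [cknD]
  calc (ENNReal.ofReal s ^ 2)⁻¹ *
        ∫⁻ v in parabolicCylinder s z, ‖p v.1 v.2 - π (v.1, v.2)‖ₑ ^ (3 / 2 : ℝ)
      ≤ (ENNReal.ofReal s ^ 2)⁻¹ * (2 * ((∫⁻ v in parabolicCylinder s z,
          ‖p v.1 v.2‖ₑ ^ (3 / 2 : ℝ)) + ∫⁻ v, ‖π v‖ₑ ^ (3 / 2 : ℝ))) := by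
        gcongr
    _ = _ := by ring

end Compare

/-! ### The `L^{3/2}` mass of the absorbed potential -/

section Mass

variable {q : ℝ} {f : ℝ → ℝ³ → ℝ³} {w : ℝ × ℝ³} {π : ℝ × ℝ³ → ℝ} {Cπ : ℝ≥0}

/-- `∫ ‖g‖ₑ^r = ‖g‖_{L^r}^r` for a real exponent `r > 0`. [folklore] -/
theorem lintegral_rpow_enorm_eq_eLpNorm_rpow {α : Type*} [MeasurableSpace α] (μ : Measure α)
    {F : Type*} [NormedAddCommGroup F] (g : α → F) {r : ℝ} (hr : 0 < r) :
    ∫⁻ x, ‖g x‖ₑ ^ r ∂μ = eLpNorm g (ENNReal.ofReal r) μ ^ r := by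
  rw [eLpNorm_eq_eLpNorm' (by simp [hr]) ENNReal.ofReal_ne_top, ENNReal.toReal_ofReal hr.le]
  exact lintegral_rpow_enorm_eq_rpow_eLpNorm' hr

/-- **The mass of `π`**: from `‖π‖_{L^{3/2}} ≤ C ‖1_{Q_1(w)} f‖_{L^{3/2}}` and Hölder on the unit
cylinder, `∫∫ |π|^{3/2} ≤ (C |B₁|^{2/3 - 1/q})^{3/2} F_q(1; w)^{3/(2q)}` for `f ∈ L^q(Q_1(w))`,
`q ≥ 3/2`. [folklore] -/
theorem lintegral_potential_rpow_le (hq : 3 / 2 ≤ q)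
    (hf : MemLp (uncurry f) (ENNReal.ofReal q) (volume.restrict (parabolicCylinder 1 w)))
    (hP : eLpNorm π p₃₂ volume ≤
      Cπ * eLpNorm ((parabolicCylinder 1 w).indicator (uncurry f)) p₃₂ volume) :
    ∫⁻ v, ‖π v‖ₑ ^ (3 / 2 : ℝ) ≤
      ((Cπ : ℝ≥0∞) * volume (ball (0 : ℝ³) 1) ^
          (1 / (p₃₂).toReal - 1 / (ENNReal.ofReal q).toReal)) ^ (3 / 2 : ℝ) *
        cknF q 1 w f ^ (3 / (2 * q)) := by
  have hq0 : 0 < q := by linarith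
  set μ := volume.restrict (parabolicCylinder 1 w)
  set V : ℝ≥0∞ := volume (ball (0 : ℝ³) 1) ^ (1 / (p₃₂).toReal - 1 / (ENNReal.ofReal q).toReal)
    with hV
  -- `‖f‖_{L^{3/2}(Q₁)} ≤ ‖f‖_{L^q(Q₁)} V`
  have hf32 : eLpNorm (uncurry f) p₃₂ μ ≤ eLpNorm (uncurry f) (ENNReal.ofReal q) μ * V := by
    have h := eLpNorm_le_eLpNorm_mul_rpow_measure_univ (p32_le_ofReal hq) hf.1 (μ := μ)
    rw [Measure.restrict_apply_univ, volume_parabolicCylinder_one] at h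
    exact h
  -- `‖f‖_{L^q(Q₁)} = F_q(1)^{1/q}`
  have hFq : eLpNorm (uncurry f) (ENNReal.ofReal q) μ = cknF q 1 w f ^ (1 / q) := by
    rw [eLpNorm_eq_lintegral_rpow_enorm_toReal (by simp [hq0]) ENNReal.ofReal_ne_top,
      ENNReal.toReal_ofReal hq0.le]
    simp only [cknF, Real.one_rpow, ENNReal.ofReal_one, one_mul]
    rfl
  -- `∫ |π|^{3/2} = ‖π‖_{3/2}^{3/2}`
  have hPm : ∫⁻ v, ‖π v‖ₑ ^ (3 / 2 : ℝ) = eLpNorm π p₃₂ volume ^ (3 / 2 : ℝ) := by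
    rw [p32_eq_ofReal]
    exact lintegral_rpow_enorm_eq_eLpNorm_rpow volume π (by norm_num)
  rw [hPm]
  calc eLpNorm π p₃₂ volume ^ (3 / 2 : ℝ)
      ≤ ((Cπ : ℝ≥0∞) * (cknF q 1 w f ^ (1 / q) * V)) ^ (3 / 2 : ℝ) := by
        refine ENNReal.rpow_le_rpow (hP.trans ?_) (by norm_num)
        rw [eLpNorm_indicator_cyl, ← hFq]
        gcongr
    _ = ((Cπ : ℝ≥0∞) * V) ^ (3 / 2 : ℝ) * cknF q 1 w f ^ (3 / (2 * q)) := by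
        rw [show (Cπ : ℝ≥0∞) * (cknF q 1 w f ^ (1 / q) * V) =
            ((Cπ : ℝ≥0∞) * V) * cknF q 1 w f ^ (1 / q) by ring,
          ENNReal.mul_rpow_of_nonneg _ _ (by norm_num), ← ENNReal.rpow_mul]
        congr 2
        field_simp

end Mass

/-! ### The estimate at unit scale -/

section Unit

/-- **The two-scale pressure estimate with a general force, unit absorption cylinder**
(Lemarié-Rieusset, proof of Thm. 14.4, the force part `ϖ_ρ` of the splitting of `ζp`, scan
pp. 506–507; here: the gradient part of `1_{Q_1(w)} f` absorbed into the pressure,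
Caffarelli–Kohn–Nirenberg 1982 §1, and the tree's `pressureEstimate`,
Robinson–Rodrigo–Sadowski 2016 Lemma 16.7, applied to `p - π`). For `q ≥ 3/2` there are
constants `κ₅, κ₆, κ₇` (depending only on `q`) such that: for `(Ω, f, u, p, G)` satisfying the
§14.3 hypotheses with `ν = 1`, a unit cylinder `Q_1(w) ⊆ Ω` with `∫∫_{Q_1(w)} |u|³ < ∞`, every
cylinder with `closure Q_r(z) ⊆ Q_1(w)` and every `0 < θ ≤ 1/2`,
`D(θr; z) ≤ κ₅ θ^{-3/2} A(r; z)^{3/4} E(r; z)^{3/4} + κ₆ θ D(r; z) + κ₇ θ⁻² r⁻² F_q(1; w)^{3/(2q)}`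
(`A = cknAEss`, `E = cknE`, `D = cknD`, `F_q = cknF q`). [cite: Lemarierieusset2023, §14.3 proof of Thm. 14.4, (14.20) (scan pp. 506–507)] -/
theorem pressureEstimate_force_unit {q : ℝ} (hq : 3 / 2 ≤ q) :
    ∃ κ₅ κ₆ κ₇ : ℝ≥0, ∀ (Ω : Opens (ℝ × ℝ³)) (f u : ℝ → ℝ³ → ℝ³) (p : ℝ → ℝ³ → ℝ)
      (G : ℝ → ℝ³ → ℝ³ →L[ℝ] ℝ³), IsLRSuitableWeakSolutionOn Ω 1 q f u p G →
      ∀ (w z : ℝ × ℝ³) (r θ : ℝ), 0 < r → 0 < θ → θ ≤ 1 / 2 →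
        closure (parabolicCylinder r z) ⊆ parabolicCylinder 1 w →
        parabolicCylinder 1 w ⊆ (Ω : Set (ℝ × ℝ³)) →
        ∫⁻ v in parabolicCylinder 1 w, ‖u v.1 v.2‖ₑ ^ (3 : ℕ) < ⊤ →
        cknD (θ * r) z p ≤
          κ₅ * ENNReal.ofReal (θ ^ (-(3 / 2 : ℝ))) * cknAEss r z u ^ (3 / 4 : ℝ) *
              cknE r z G ^ (3 / 4 : ℝ) +
            κ₆ * ENNReal.ofReal θ * cknD r z p +
            κ₇ * ENNReal.ofReal ((θ ^ 2)⁻¹ * (r ^ 2)⁻¹) * cknF q 1 w f ^ (3 / (2 * q)) := by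
  obtain ⟨κ₅, κ₆, hPE⟩ := pressureEstimate_holds
  obtain ⟨Cg, Cπ, hH⟩ := exists_localHelmholtz (p := ENNReal.ofReal q) (p32_le_ofReal hq)
    ENNReal.ofReal_lt_top
  have hq1 : 1 ≤ q := by linarith
  -- the mass constant `K = (Cπ V)^{3/2}`
  set V : ℝ≥0∞ := volume (ball (0 : ℝ³) 1) ^ (1 / (p₃₂).toReal - 1 / (ENNReal.ofReal q).toReal)
    with hV
  have hVtop : V ≠ ⊤ := volumeFactor_ne_top hq
  set K : ℝ≥0∞ := ((Cπ : ℝ≥0∞) * V) ^ (3 / 2 : ℝ) with hK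
  have hKtop : K ≠ ⊤ :=
    ENNReal.rpow_ne_top_of_nonneg (by norm_num) (ENNReal.mul_ne_top ENNReal.coe_ne_top hVtop)
  set κ₇ : ℝ≥0 := ((4 * (κ₆ : ℝ≥0∞) + 2) * K).toNNReal with hκ₇
  have hκ₇eq : (κ₇ : ℝ≥0∞) = (4 * (κ₆ : ℝ≥0∞) + 2) * K := by
    rw [hκ₇, ENNReal.coe_toNNReal]
    exact ENNReal.mul_ne_top
      (ENNReal.add_ne_top.2 ⟨ENNReal.mul_ne_top (by simp) ENNReal.coe_ne_top, by simp⟩) hKtop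
  refine ⟨2 * κ₅, 4 * κ₆, κ₇, ?_⟩
  intro Ω f u p G hS w z r θ hr hθ hθ2 hcl hsub hu3
  -- ### the absorbed datum on `Q_1(w)`
  obtain ⟨π, 𝒢, hπ, h𝒢, -, hP, hgrad, hdiv, πs, hπs, htπ, ht𝒢⟩ :=
    hH w ((parabolicCylinder 1 w).indicator (uncurry f)) (memLp_indicator_cyl (memLp_f hS hsub))
      support_indicator_subset
  have hS' := isLRSuitableWeakSolutionOn_absorb hS hq hsub hu3 hπ h𝒢 hgrad hπs htπ ht𝒢
  have hdiv' : ∀ φ : ℝ → ℝ³ → ℝ, IsSpaceTimeTestOn (parabolicCylinderOpens 1 w) φ →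
      ∫ t, ∫ x, ⟪(fun t x => f t x - 𝒢 (t, x)) t x, gradient (φ t) x⟫ = 0 :=
    fun φ hφ => divFree_absorb hS hq hsub h𝒢 hdiv hφ
  have hsol' := hS'.isSuitableWeakSolutionOn
  have hfloc : LocallyIntegrableOn (uncurry fun t x => f t x - 𝒢 (t, x))
      ((parabolicCylinderOpens 1 w : Opens (ℝ × ℝ³)) : Set (ℝ × ℝ³)) volume :=
    locallyIntegrableOn_of_memLp hq1 hS'.force_memLp
  have hcl' : closure (parabolicCylinder r z) ⊆
      ((parabolicCylinderOpens 1 w : Opens (ℝ × ℝ³)) : Set (ℝ × ℝ³)) := by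
    rwa [coe_parabolicCylinderOpens]
  -- ### the pressure estimate for `p - π`
  have key := hPE (parabolicCylinderOpens 1 w) (fun t x => f t x - 𝒢 (t, x)) u
    (fun t x => p t x - π (t, x)) G hsol' hfloc hdiv' hS'.weakGradient z r θ hr hθ hθ2 hcl'
  -- ### back to `p`
  set Pm : ℝ≥0∞ := ∫⁻ v, ‖π v‖ₑ ^ (3 / 2 : ℝ) with hPmdef
  set M : ℝ≥0∞ := cknAEss r z u ^ (3 / 4 : ℝ) * cknE r z G ^ (3 / 4 : ℝ) with hM
  have h1 := cknD_le_two_mul_sub hπ.1 (θ * r) z p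
  have h3 := cknD_sub_le_two_mul hπ.1 r z p
  have h4 : Pm ≤ K * cknF q 1 w f ^ (3 / (2 * q)) :=
    lintegral_potential_rpow_le hq (memLp_f hS hsub) hP
  -- the real coefficients
  have hθr : 0 < θ * r := mul_pos hθ hr
  have ha₁ : (ENNReal.ofReal (θ * r) ^ 2)⁻¹ = ENNReal.ofReal ((θ ^ 2)⁻¹ * (r ^ 2)⁻¹) := by
    rw [← ENNReal.ofReal_pow hθr.le, ← ENNReal.ofReal_inv_of_pos (by positivity)]
    congr 1
    field_simp
  have ha₂ : ENNReal.ofReal θ * (ENNReal.ofReal r ^ 2)⁻¹ ≤ ENNReal.ofReal ((θ ^ 2)⁻¹ * (r ^ 2)⁻¹) := by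
    rw [← ENNReal.ofReal_pow hr.le, ← ENNReal.ofReal_inv_of_pos (by positivity),
      ← ENNReal.ofReal_mul hθ.le]
    refine ENNReal.ofReal_le_ofReal (mul_le_mul_of_nonneg_right ?_ (by positivity))
    -- `θ ≤ θ⁻²` for `0 < θ ≤ 1/2`
    rw [← one_div, le_div_iff₀ (by positivity : (0 : ℝ) < θ ^ 2)]
    nlinarith
  set a : ℝ≥0∞ := ENNReal.ofReal ((θ ^ 2)⁻¹ * (r ^ 2)⁻¹) with ha
  -- assemble
  have e5 : ((2 * κ₅ : ℝ≥0) : ℝ≥0∞) = 2 * (κ₅ : ℝ≥0∞) := by push_cast; rfl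
  have e6 : ((4 * κ₆ : ℝ≥0) : ℝ≥0∞) = 4 * (κ₆ : ℝ≥0∞) := by push_cast; rfl
  rw [e5, e6, hκ₇eq]
  calc cknD (θ * r) z p
      ≤ 2 * (cknD (θ * r) z (fun t x => p t x - π (t, x)) + (ENNReal.ofReal (θ * r) ^ 2)⁻¹ * Pm) := h1
    _ ≤ 2 * ((κ₅ * ENNReal.ofReal (θ ^ (-(3 / 2 : ℝ))) * cknAEss r z u ^ (3 / 4 : ℝ) *
            cknE r z G ^ (3 / 4 : ℝ) +
          κ₆ * ENNReal.ofReal θ * cknD r z (fun t x => p t x - π (t, x))) + a * Pm) := by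
        rw [ha₁]; gcongr
    _ ≤ 2 * ((κ₅ * ENNReal.ofReal (θ ^ (-(3 / 2 : ℝ))) * cknAEss r z u ^ (3 / 4 : ℝ) *
            cknE r z G ^ (3 / 4 : ℝ) +
          κ₆ * ENNReal.ofReal θ * (2 * (cknD r z p + (ENNReal.ofReal r ^ 2)⁻¹ * Pm))) + a * Pm) := by
        gcongr
    _ = 2 * (κ₅ : ℝ≥0∞) * ENNReal.ofReal (θ ^ (-(3 / 2 : ℝ))) * cknAEss r z u ^ (3 / 4 : ℝ) *
            cknE r z G ^ (3 / 4 : ℝ) +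
          4 * (κ₆ : ℝ≥0∞) * ENNReal.ofReal θ * cknD r z p +
          (4 * (κ₆ : ℝ≥0∞) * (ENNReal.ofReal θ * (ENNReal.ofReal r ^ 2)⁻¹) + 2 * a) * Pm := by
        ring
    _ ≤ 2 * (κ₅ : ℝ≥0∞) * ENNReal.ofReal (θ ^ (-(3 / 2 : ℝ))) * cknAEss r z u ^ (3 / 4 : ℝ) *
            cknE r z G ^ (3 / 4 : ℝ) +
          4 * (κ₆ : ℝ≥0∞) * ENNReal.ofReal θ * cknD r z p +
          (4 * (κ₆ : ℝ≥0∞) * a + 2 * a) * (K * cknF q 1 w f ^ (3 / (2 * q))) := by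
        gcongr
    _ = _ := by ring

end Unit

/-! ### Every scale -/

section Scaled

/-- The zoom `Φ(s, y) = (t₀ + R² s, x₀ + R y)` pulls back closures of sets to closures of
preimages (it is a homeomorphism). [folklore] -/
theorem stAffine_sq_preimage_closure {R : ℝ} (hR : 0 < R) (w : ℝ × ℝ³) (S : Set (ℝ × ℝ³)) :
    stAffine (R ^ 2) R w.1 w.2 ⁻¹' closure S = closure (stAffine (R ^ 2) R w.1 w.2 ⁻¹' S) := by
  have e : ⇑(stAffineHomeomorph (by positivity : R ^ 2 ≠ 0) hR.ne' w.1 w.2) =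
      stAffine (R ^ 2) R w.1 w.2 := rfl
  rw [← e]
  exact (stAffineHomeomorph (by positivity : R ^ 2 ≠ 0) hR.ne' w.1 w.2).preimage_closure S

/-- **The two-scale pressure estimate with a general force** (Lemarié-Rieusset, proof of
Thm. 14.4, (14.20) with the force part `ϖ_ρ`, scan pp. 506–507; Caffarelli–Kohn–Nirenberg 1982
§1; Robinson–Rodrigo–Sadowski 2016 Lemma 16.7). For `q ≥ 3/2` there are constants `κ₅, κ₆, κ₇`
depending only on `q` such that: for `(Ω, f, u, p, G)` satisfying the §14.3 hypotheses with
`ν = 1` (`IsLRSuitableWeakSolutionOn`, force **not** assumed solenoidal), an absorption cylinder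
`Q_R(w) ⊆ Ω` with `∫∫_{Q_R(w)} |u|³ < ∞`, every cylinder with `closure Q_r(z) ⊆ Q_R(w)` and every
`0 < θ ≤ 1/2`,
`D(θr; z) ≤ κ₅ θ^{-3/2} A(r; z)^{3/4} E(r; z)^{3/4} + κ₆ θ D(r; z) + κ₇ θ⁻² (R/r)² F_q(R; w)^{3/(2q)}`,
`F_q(R; w) = R^{3q-5} ∫∫_{Q_R(w)} |f|^q`. From the unit case by the Navier–Stokes scaling about `w`
(`IsLRSuitableWeakSolutionOn.nsRescale`; `A, E, D, F_q` are scale invariant). [cite: Lemarierieusset2023, §14.3 proof of Thm. 14.4, (14.20) (scan pp. 506–507)] -/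
theorem pressureEstimate_force {q : ℝ} (hq : 3 / 2 ≤ q) :
    ∃ κ₅ κ₆ κ₇ : ℝ≥0, ∀ (Ω : Opens (ℝ × ℝ³)) (f u : ℝ → ℝ³ → ℝ³) (p : ℝ → ℝ³ → ℝ)
      (G : ℝ → ℝ³ → ℝ³ →L[ℝ] ℝ³), IsLRSuitableWeakSolutionOn Ω 1 q f u p G →
      ∀ (w z : ℝ × ℝ³) (R r θ : ℝ), 0 < R → 0 < r → 0 < θ → θ ≤ 1 / 2 →
        closure (parabolicCylinder r z) ⊆ parabolicCylinder R w →
        parabolicCylinder R w ⊆ (Ω : Set (ℝ × ℝ³)) →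
        ∫⁻ v in parabolicCylinder R w, ‖u v.1 v.2‖ₑ ^ (3 : ℕ) < ⊤ →
        cknD (θ * r) z p ≤
          κ₅ * ENNReal.ofReal (θ ^ (-(3 / 2 : ℝ))) * cknAEss r z u ^ (3 / 4 : ℝ) *
              cknE r z G ^ (3 / 4 : ℝ) +
            κ₆ * ENNReal.ofReal θ * cknD r z p +
            κ₇ * ENNReal.ofReal ((θ ^ 2)⁻¹ * (R / r) ^ 2) * cknF q R w f ^ (3 / (2 * q)) := by
  obtain ⟨κ₅, κ₆, κ₇, H⟩ := pressureEstimate_force_unit hq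
  refine ⟨κ₅, κ₆, κ₇, fun Ω f u p G hS w z R r θ hR hr hθ hθ2 hcl hsub hu3 => ?_⟩
  have hq0 : 0 ≤ q := by linarith
  have hR2 : (0 : ℝ) < R ^ 2 := by positivity
  -- the zoomed datum about `w`
  have hS' := hS.nsRescale hR w.1 w.2
  have hpre : ∀ (v : ℝ × ℝ³) (ρ : ℝ), stAffine (R ^ 2) R w.1 w.2 ⁻¹' parabolicCylinder ρ v =
      parabolicCylinder (ρ / R) ((v.1 - w.1) / R ^ 2, R⁻¹ • (v.2 - w.2)) :=
    fun v ρ => stAffine_sq_preimage_parabolicCylinder' hR w v ρ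
  have hpre1 : stAffine (R ^ 2) R w.1 w.2 ⁻¹' parabolicCylinder R w =
      parabolicCylinder 1 (0 : ℝ × ℝ³) := by
    rw [stAffine_sq_preimage_parabolicCylinder hR w R, div_self hR.ne']
  set z' : ℝ × ℝ³ := ((z.1 - w.1) / R ^ 2, R⁻¹ • (z.2 - w.2)) with hz'
  have hΦz' : stAffine (R ^ 2) R w.1 w.2 z' = z := stAffine_sq_apply_symm hR w z
  have hΦ0 : stAffine (R ^ 2) R w.1 w.2 (0 : ℝ × ℝ³) = w :=
    Prod.ext (by simp [stAffine]) (by simp [stAffine])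
  -- the hypotheses at unit scale
  have hcl₁ : closure (parabolicCylinder (r / R) z') ⊆ parabolicCylinder 1 (0 : ℝ × ℝ³) := by
    rw [← hpre z r, ← hpre1, ← stAffine_sq_preimage_closure hR w]
    exact preimage_mono hcl
  have hsub₁ : parabolicCylinder 1 (0 : ℝ × ℝ³) ⊆
      ((stPreimage (R ^ 2) R w.1 w.2 Ω : Opens (ℝ × ℝ³)) : Set (ℝ × ℝ³)) := by
    rw [coe_stPreimage, ← hpre1]
    exact preimage_mono hsub
  have hu3₁ : ∫⁻ v in parabolicCylinder 1 (0 : ℝ × ℝ³),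
      ‖(R • stPull (R ^ 2) R w.1 w.2 u) v.1 v.2‖ₑ ^ (3 : ℕ) < ⊤ := by
    have hpt : ∀ v : ℝ × ℝ³, ‖(R • stPull (R ^ 2) R w.1 w.2 u) v.1 v.2‖ₑ ^ (3 : ℕ) =
        (fun v' : ℝ × ℝ³ => ENNReal.ofReal R ^ (3 : ℕ) * ‖u v'.1 v'.2‖ₑ ^ (3 : ℕ))
          (stAffine (R ^ 2) R w.1 w.2 v) := by
      intro v
      rw [smul_stPull_apply, enorm_smul, mul_pow, Real.enorm_eq_ofReal hR.le]
      rfl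
    simp_rw [hpt]
    rw [← hpre1, setLIntegral_preimage_comp_stAffine hR2 hR w.1 w.2
      (fun v' : ℝ × ℝ³ => ENNReal.ofReal R ^ (3 : ℕ) * ‖u v'.1 v'.2‖ₑ ^ (3 : ℕ)),
      lintegral_const_mul' _ _ (by simp)]
    exact ENNReal.mul_lt_top ENNReal.ofReal_lt_top (ENNReal.mul_lt_top (by simp) hu3)
  have key := H _ _ _ _ _ hS' 0 z' (r / R) θ (by positivity) hθ hθ2 hcl₁ hsub₁ hu3₁
  -- transport back
  have hρ : 0 < θ * (r / R) := by positivity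
  have hD1 : cknD (θ * (r / R)) z' (R ^ 2 • stPull (R ^ 2) R w.1 w.2 p) = cknD (θ * r) z p := by
    rw [cknD_nsZoom hR hρ w.1 w.2 z' p, hΦz']
    congr 1
    field_simp
  have hD2 : cknD (r / R) z' (R ^ 2 • stPull (R ^ 2) R w.1 w.2 p) = cknD r z p := by
    rw [cknD_nsZoom hR (by positivity) w.1 w.2 z' p, hΦz']
    congr 1
    field_simp
  have hA : cknAEss (r / R) z' (R • stPull (R ^ 2) R w.1 w.2 u) = cknAEss r z u := by
    rw [cknAEss_nsZoom hR (by positivity) w.1 w.2 z' u, hΦz']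
    congr 1
    field_simp
  have hE : cknE (r / R) z' ((R * R) • stPull (R ^ 2) R w.1 w.2 G) = cknE r z G := by
    rw [← sq, cknE_nsZoom hR (by positivity) w.1 w.2 z' G, hΦz']
    congr 1
    field_simp
  have hF : cknF q 1 0 ((R ^ 2 * R) • stPull (R ^ 2) R w.1 w.2 f) = cknF q R w f := by
    rw [show R ^ 2 * R = R ^ 3 by ring, cknF_nsZoom hR one_pos hq0 w.1 w.2 0 f, hΦ0, mul_one]
  have hcoef : ((r / R) ^ 2)⁻¹ = (R / r) ^ 2 := by
    rw [← inv_pow, inv_div]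
  rw [hD1, hD2, hA, hE, hF, hcoef] at key
  exact key

end Scaled

end Literature.Analysis.FluidPDE
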